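import Literature.AlgebraicGeometry.Resolution.CohenMacaulayAvoidance
import Literature.AlgebraicGeometry.Resolution.DimensionFormula
import Mathlib.RingTheory.Ideal.KrullsHeightTheorem
import Mathlib.RingTheory.HopkinsLevitzki
import Mathlib.RingTheory.KrullDimension.Zero
import HarnessLib

/-!
# In a regular local ring a system of parameters is a regular sequence

Matsumura, *Commutative Ring Theory*, Thm. 17.4 (iii) with Thm. 17.8 ("a regular local ring is
Cohen–Macaulay"; "if `a₁, …, a_r` is part of a system of parameters then it is an `A`-sequence");
Bruns–Herzog 2.1.2 (d). For a regular local ring `(R, 𝔪)` of dimension `d` and `d` elements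
`Q₁, …, Q_d ∈ 𝔪` generating an `𝔪`-primary ideal (`𝔪ᴺ ⊆ (Q)`), the sequence `Q₁, …, Q_d` is
`R`-regular, in the given (hence in any) order — `isRegular_of_maximalIdeal_pow_le_ofList`.

Proof: the tree's Cohen–Macaulay avoidance theorem
(`Literature.AlgebraicGeometry.Resolution.isRegular_of_forall_notMem_minimalPrimes`, fed with the
regular sequence of length `dim R` of `exists_isRegular_length_eq_ringKrullDim`) reduces this to
checking that `Q_{l+1}` lies in no minimal prime `𝔭` of `(Q₁, …, Q_l)`; if it did, Krull's
height theorem (`ht 𝔭 ≤ l`), the bound `dim R/𝔭 ≤ d - l - 1` (the images of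
`Q_{l+2}, …, Q_d` generate an `𝔪/𝔭`-primary ideal) and the dimension formula
`ht 𝔭 + dim R/𝔭 = dim R` of the catenary domain `R`
(`IsCatenaryRing.height_eq_height_add_height_map_quotientMk`) would give `d ≤ d - 1`. This is
the input "`p₁, …, pₙ` is `P`-regular" of de Smit–Rubin–Schoof, Prop. 2.1, for power series
rings over a field. Everything here is proved; no named facts.

## References

* H. Matsumura, *Commutative Ring Theory*, CUP 1986, Thm. 17.4 (iii), Thm. 17.8.
  [Matsumura1987]
-/

namespace Literature.RingTheory.RegularLocalRing

universe u

open IsLocalRing RingTheory.Sequence Literature.AlgebraicGeometry.Resolution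

variable {R : Type u} [CommRing R]

/-- The height of a minimal prime of the ideal of a list is at most the length of the list
(Krull's height theorem). [folklore] -/
theorem height_le_length_of_mem_minimalPrimes_ofList [IsNoetherianRing R] {L : List R}
    {p : Ideal R} (hp : p ∈ (Ideal.ofList L).minimalPrimes) : p.height ≤ L.length := by
  classical
  have hfin : ({r | r ∈ L} : Set R).Finite := by
    rw [← List.coe_toFinset]
    exact L.toFinset.finite_toSet
  refine (Ideal.height_le_card_of_mem_minimalPrimes_span hfin hp).trans ?_
  rw [← List.coe_toFinset, Set.ncard_coe_finset]
  exact_mod_cast List.toFinset_card_le L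

/-- A Noetherian local ring whose maximal ideal has a power inside the ideal of a list of `r`
elements has dimension at most `r`. [folklore] -/
theorem ringKrullDim_le_length_of_maximalIdeal_pow_le [IsLocalRing R] [IsNoetherianRing R]
    {L : List R} (hL : ∀ r ∈ L, r ∈ maximalIdeal R) {N : ℕ}
    (hN : maximalIdeal R ^ N ≤ Ideal.ofList L) : ringKrullDim R ≤ L.length := by
  classical
  set I : Ideal R := Ideal.ofList L with hI
  have hIm : I ≤ maximalIdeal R := by
    rw [hI, Ideal.span_le]
    exact fun r hr => hL r hr
  -- `R ⧸ I` is a local ring with nilpotent maximal ideal, hence of dimension `0`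
  have hItop : I ≠ ⊤ := fun h => (maximalIdeal.isMaximal R).ne_top (top_le_iff.mp (h ▸ hIm))
  haveI : Nontrivial (R ⧸ I) := Ideal.Quotient.nontrivial_iff.mpr hItop
  haveI : IsLocalRing (R ⧸ I) :=
    IsLocalRing.of_surjective' (Ideal.Quotient.mk I) Ideal.Quotient.mk_surjective
  have hnil : IsNilpotent (maximalIdeal (R ⧸ I)) := by
    refine ⟨N, ?_⟩
    rw [← map_maximalIdeal_of_surjective (Ideal.Quotient.mk I) Ideal.Quotient.mk_surjective,
      ← Ideal.map_pow, Ideal.zero_eq_bot, Ideal.map_eq_bot_iff_le_ker, Ideal.mk_ker]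
    exact hN
  haveI : IsArtinianRing (R ⧸ I) := (isArtinianRing_iff_isNilpotent_maximalIdeal _).mpr hnil
  have h0 : ringKrullDim (R ⧸ I) = 0 := by
    rw [← ringKrullDimZero_iff_ringKrullDim_eq_zero]
    infer_instance
  -- `dim R ≤ dim R/I + μ(I) ≤ 0 + |L|`
  have hjac : I ≤ Ring.jacobson R := by
    rw [Ring.jacobson_eq_sInf_isMaximal]
    refine le_sInf fun m hm => ?_
    rw [Set.mem_setOf_eq] at hm
    rw [IsLocalRing.eq_maximalIdeal hm]
    exact hIm
  have h1 := ringKrullDim_le_ringKrullDim_quotient_add_spanFinrank I hjac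
  rw [h0, zero_add] at h1
  refine h1.trans ?_
  have hfin : ({r | r ∈ L} : Set R).Finite := by
    rw [← List.coe_toFinset]
    exact L.toFinset.finite_toSet
  have h2 : I.spanFinrank ≤ L.length := by
    refine (Submodule.spanFinrank_span_le_ncard_of_finite hfin).trans ?_
    rw [← List.coe_toFinset, Set.ncard_coe_finset]
    exact List.toFinset_card_le L
  exact WithBot.coe_le_coe.mpr (Nat.cast_le.mpr h2)

/-- **In a regular local ring a system of parameters is a regular sequence** (Matsumura
Thm. 17.4 (iii) with Thm. 17.8; Bruns–Herzog 2.1.2): if `Q₁, …, Q_d ∈ 𝔪`, `d = dim R`, generate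
an `𝔪`-primary ideal (`𝔪ᴺ ⊆ (Q₁, …, Q_d)`), then `Q₁, …, Q_d` is an `R`-regular sequence.
[cite: Matsumura1987, Thm. 17.4 (iii)] -/
theorem isRegular_of_maximalIdeal_pow_le_ofList [IsRegularLocalRing R] {Q : List R}
    (hQm : ∀ q ∈ Q, q ∈ maximalIdeal R) (hlen : (Q.length : WithBot ℕ∞) = ringKrullDim R) {N : ℕ}
    (hN : maximalIdeal R ^ N ≤ Ideal.ofList Q) : IsRegular R Q := by
  classical
  haveI := isDomain_of_isRegularLocalRing R
  obtain ⟨rs, hrs, hrsm, hrslen⟩ := exists_isRegular_length_eq_ringKrullDim R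
  refine isRegular_of_forall_notMem_minimalPrimes hrs hrsm hrslen hQm ?_
  intro L₁ q L₂ hdec 𝔭 h𝔭 hq
  haveI h𝔭p : 𝔭.IsPrime := h𝔭.1.1
  have hL₁𝔭 : Ideal.ofList L₁ ≤ 𝔭 := h𝔭.1.2
  -- (a) Krull: `ht 𝔭 ≤ |L₁|`
  have ha : 𝔭.height ≤ L₁.length := height_le_length_of_mem_minimalPrimes_ofList h𝔭
  -- (b) `𝔪ᴺ ⊆ 𝔭 + (L₂)`, so `dim R/𝔭 ≤ |L₂|`
  have h𝔭m : 𝔭 ≤ maximalIdeal R := IsLocalRing.le_maximalIdeal h𝔭p.ne_top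
  have h𝔭top : 𝔭 ≠ ⊤ := h𝔭p.ne_top
  haveI : Nontrivial (R ⧸ 𝔭) := Ideal.Quotient.nontrivial_iff.mpr h𝔭top
  haveI : IsLocalRing (R ⧸ 𝔭) :=
    IsLocalRing.of_surjective' (Ideal.Quotient.mk 𝔭) Ideal.Quotient.mk_surjective
  set π := Ideal.Quotient.mk 𝔭 with hπ
  have hb : ringKrullDim (R ⧸ 𝔭) ≤ L₂.length := by
    have h := ringKrullDim_le_length_of_maximalIdeal_pow_le (R := R ⧸ 𝔭) (L := L₂.map π)
      (fun r hr => by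
        obtain ⟨s, hs, rfl⟩ := List.mem_map.mp hr
        rw [← map_maximalIdeal_of_surjective π Ideal.Quotient.mk_surjective]
        exact Ideal.mem_map_of_mem _ (hQm s (by rw [hdec]; simp [hs]))) (N := N) ?_
    · rwa [List.length_map] at h
    · rw [← map_maximalIdeal_of_surjective π Ideal.Quotient.mk_surjective, ← Ideal.map_pow,
        ← Ideal.map_ofList]
      refine (Ideal.map_mono hN).trans ?_
      rw [hdec, Ideal.ofList_append, Ideal.ofList_cons, Ideal.map_sup, Ideal.map_sup,
        (Ideal.map_eq_bot_iff_le_ker π).mpr (by rw [hπ, Ideal.mk_ker]; exact hL₁𝔭),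
        (Ideal.map_eq_bot_iff_le_ker π).mpr (by
          rw [hπ, Ideal.mk_ker, Ideal.span_singleton_le_iff_mem]; exact hq),
        bot_sup_eq, bot_sup_eq]
  -- (c) dimension formula in the catenary domain `R`: `ht 𝔪 = ht 𝔭 + ht(𝔪/𝔭)`
  have hcat := (isCatenaryRing_of_isRegularLocalRing R).height_eq_height_add_height_map_quotientMk
    h𝔭m
  -- (d) arithmetic: `d = |L₁| + 1 + |L₂|`, `d ≤ |L₁| + |L₂|`
  obtain ⟨d, hd⟩ := exists_nat_cast_eq_ringKrullDim (R := R)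
  obtain ⟨d', hd'⟩ := exists_nat_cast_eq_ringKrullDim (R := R ⧸ 𝔭)
  have hmR : (maximalIdeal R).height = d := by
    have h := IsLocalRing.maximalIdeal_height_eq_ringKrullDim (R := R)
    rw [hd] at h
    exact_mod_cast h
  have hmR' : (maximalIdeal (R ⧸ 𝔭)).height = d' := by
    have h := IsLocalRing.maximalIdeal_height_eq_ringKrullDim (R := R ⧸ 𝔭)
    rw [hd'] at h
    exact_mod_cast h
  rw [map_maximalIdeal_of_surjective π Ideal.Quotient.mk_surjective, hmR, hmR'] at hcat
  obtain ⟨h, hh⟩ := ENat.ne_top_iff_exists.mp (Ideal.height_ne_top h𝔭top)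
  rw [← hh] at ha hcat
  have hsum : d = h + d' := by exact_mod_cast hcat
  have ha' : h ≤ L₁.length := by exact_mod_cast ha
  have hb' : d' ≤ L₂.length := by
    rw [hd'] at hb
    exact Nat.cast_le.mp (WithBot.coe_le_coe.mp hb)
  have hlenQ : Q.length = L₁.length + 1 + L₂.length := by
    rw [hdec, List.length_append, List.length_cons]
    omega
  have hdQ : d = Q.length := by
    rw [hd] at hlen
    exact Nat.cast_injective (WithBot.coe_injective hlen.symm)
  omega

end Literature.RingTheory.RegularLocalRing
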